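import Mathlib
import Summits.MatrixMultiplication.Statement
import Summits.MatrixMultiplication.MatrixMultiplication.Theorems.GraphEquationsTestCount

/-!
# The masked SQUARE cubic system: `AQRₙ` and `C3ₙ` are FALSE for every `n ≥ 2` (`GraphEquations`, M51)

Decomp-mm node «GraphEquations» (lens 5 «finite range + asymptotic regime + bridge», g41); attacked
leaf `MultiplicityReduction` (stmt-MatrixMultiplication-27806).  Target VERBATIM:
`_root_.MatrixMultiplication`.  Route-neutral: the cut `closes (hV) (hM)` is untouched; this file
DECIDES the finite-algebra node of NODE-g38 – g40 (rung `3` of the degree ladder) NEGATIVELY.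

Fix two distinct rows `r ≠ s` and a column `j₀`; write `f = C − AB`, pivot `⋆ = (s, j₀)`.  The
`n²` affine (= cubic) tests
* `f_q`                                  for `q` outside row `r` and `q ≠ ⋆`   (`coordTest`),
* `f_{(r,k)} − a_{sk} · f_⋆`              for `k < n`                           (`slotTest`),
* `c_⋆ · f_⋆ − Σ_k b_{k j₀} · f_{(r,k)}`                                         (`pivotTest`)
form the system `cubicMaskSystem r s j₀` with:
* `cubicMaskSystem_correct` — its zero set is EXACTLY the graph: on the zeros of the first two groups
  `f = f_⋆ · Λ(A)` with `Λ = e_⋆ + Σ_k a_{sk} e_{(r,k)}`, and there the pivot test equals `f_⋆²`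
  (`pivotTest_eval_add`: `T + Σ_k b_{kj₀}·t_{(r,k)} = f_⋆²` identically — the UNMASKING identity,
  `n` products and `n` sums);
* `cubicMaskSystem_isKer` / `cubicMaskSystem_nowhereReduced` — the degree-`1` field `Λ(A) ≠ 0` is a kernel
  direction of the `C`-Jacobian at EVERY graph point (corank `≥ 1` everywhere);
* exactly ONE test has a quadratic part (`M_⋆ = e_⋆ ⊗ e_⋆`, `quad_pivotTest`; all other `M = 0`),
  and `β_⋆(Λ) = 1` (`pivotTest_quad_kerField`): this is PRECISELY the object NODE-g40 §3f / critic
  g18 r1 / writer G35 asked to «exclude or exhibit on paper first» (`m_q = 1`, constant corank `1`,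
  `J₀·w ≡ 0`, `q₀∘w ≡ 1`) — EXHIBITED, for all `n ≥ 2`, with `m = n²` tests (the minimum allowed by
  `AffSystem.Correct.sq_le_m`, M48).
The consequences BY NAME (`¬ AQRₙ`, `¬ C3ₙ` for `n ≥ 2`, the `n ≤ 1` characterisations, unmasking by
one generator) are drawn in `GraphEquationsCubicRefutation` (M51b).  No `sorry`.
Sources: [BurgisserClausenShokrollahi1997, Problem 16.3, (15.1)]; [Strassen1973]; the cell's own
M34 `GraphEquationsCubicMasking` (near-miss `S_{x⊗y}`, correct only off the isotropic cone).
-/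

-- dupNamespace: forced by the nested Summit.MatrixMultiplication.MatrixMultiplication layout (D-0017)
set_option linter.dupNamespace false

noncomputable section

namespace Summit.MatrixMultiplication.MatrixMultiplication.Theorems.GraphEquations

open Matrix

variable {n : ℕ}

/-! ## Elementary coefficient operators -/

/-- The elementary operator `X ↦ X_v · e_p`. -/
def unitOp (p v : Fin n × Fin n) : SqMat n :=
  Matrix.of fun p' v' => if p' = p ∧ v' = v then 1 else 0

/-- `unitOp p v` sends `X` to `X_v · e_p`. -/
theorem unitOp_mulVec (p v : Fin n × Fin n) (X : Vec n) :
    unitOp p v *ᵥ X = X v • Pi.single p (1 : ℂ) := by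
  ext q
  by_cases hq : q = p
  · subst hq
    simp [unitOp, mulVec, dotProduct, ite_and]
  · simp [unitOp, mulVec, dotProduct, hq]

/-- The operator `B ↦ Σ_k B_{(k, j₀)} · e_{(r,k)}` (row `r` receives column `j₀` of `B`). -/
def slotOp (r j₀ : Fin n) : SqMat n :=
  Matrix.of fun p v => if p.1 = r ∧ v = (p.2, j₀) then 1 else 0

/-- `slotOp r j₀` sends `B` to the vector supported on row `r` with entries `B_{(k, j₀)}`. -/
theorem slotOp_mulVec (r j₀ : Fin n) (B : Vec n) :
    slotOp r j₀ *ᵥ B = fun p => if p.1 = r then B (p.2, j₀) else 0 := by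
  ext p
  by_cases hp : p.1 = r
  · simp [slotOp, mulVec, dotProduct, hp]
  · simp [slotOp, mulVec, dotProduct, hp]

/-! ## The three kinds of tests -/

/-- SLOT test `f_{(r,k)} − a_{sk} · f_{(s,j₀)}`: `κ = e_{(r,k)}`, `L_A A = −a_{sk} e_⋆`, no `B`- or
`C`-part. -/
def slotTest (r s j₀ k : Fin n) : AffTest n :=
  ⟨Pi.single (r, k) 1, -unitOp (s, j₀) (s, k), 0, 0⟩

/-- PIVOT test `c_⋆ · f_⋆ − Σ_k b_{kj₀} · f_{(r,k)}`: `κ = 0`, `L_A = 0`, `L_B B = −Σ_k b_{kj₀} e_{(r,k)}`,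
`M C = c_⋆ e_⋆` — the ONLY test with a quadratic part. -/
def pivotTest (r s j₀ : Fin n) : AffTest n :=
  ⟨0, 0, -slotOp r j₀, unitOp (s, j₀) (s, j₀)⟩

/-- The test at position `q`: slot tests on row `r`, the pivot test at `⋆ = (s, j₀)`, coordinate tests
elsewhere. -/
def cubicMaskTest (r s j₀ : Fin n) (q : Fin n × Fin n) : AffTest n :=
  if q.1 = r then slotTest r s j₀ q.2 else if q = (s, j₀) then pivotTest r s j₀ else coordTest q

/-- **The masked square system**: `n²` cubic tests indexed by positions. -/
def cubicMaskSystem (r s j₀ : Fin n) : AffSystem n :=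
  ⟨n * n, fun j => cubicMaskTest r s j₀ ((flat n).symm j)⟩

/-- The masked system is SQUARE: `m = n²` (the minimum for a correct system, `Correct.sq_le_m`). -/
theorem cubicMaskSystem_m (r s j₀ : Fin n) : (cubicMaskSystem r s j₀).m = n * n := rfl

/-- The test of the masked system at flat index `flat n q` is the test at position `q`. -/
theorem cubicMaskSystem_test (r s j₀ : Fin n) (q : Fin n × Fin n) :
    (cubicMaskSystem r s j₀).test (flat n q) = cubicMaskTest r s j₀ q := by
  simp [cubicMaskSystem]

section evals

variable (r s j₀ : Fin n) (A B C : Vec n)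

/-- Coefficient vector of a slot test: `e_{(r,k)} − a_{sk} e_⋆`. -/
theorem slotTest_coef (k : Fin n) :
    (slotTest r s j₀ k).coef A B C = Pi.single (r, k) 1 - A (s, k) • Pi.single (s, j₀) 1 := by
  simp [slotTest, AffTest.coef, Matrix.neg_mulVec, unitOp_mulVec, sub_eq_add_neg]

/-- Value of a slot test: `f_{(r,k)} − a_{sk} · f_⋆`. -/
theorem slotTest_eval (k : Fin n) :
    (slotTest r s j₀ k).eval A B C =
      (C - prodVec A B) (r, k) - A (s, k) * (C - prodVec A B) (s, j₀) := by
  rw [AffTest.eval, slotTest_coef, sub_dotProduct, smul_dotProduct, single_dotProduct,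
    single_dotProduct, one_mul, one_mul, smul_eq_mul]

/-- Gradient of a slot test on the graph: `e_{(r,k)} − a_{sk} e_⋆`. -/
theorem slotTest_jac (k : Fin n) :
    (slotTest r s j₀ k).jac A B = Pi.single (r, k) 1 - A (s, k) • Pi.single (s, j₀) 1 :=
  slotTest_coef r s j₀ A B _ k

/-- Coefficient vector of the pivot test: `c_⋆ e_⋆ − Σ_k b_{kj₀} e_{(r,k)}`. -/
theorem pivotTest_coef :
    (pivotTest r s j₀).coef A B C =
      C (s, j₀) • Pi.single (s, j₀) 1 - fun p => if p.1 = r then B (p.2, j₀) else 0 := by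
  simp only [pivotTest, AffTest.coef, zero_mulVec, add_zero, zero_add, neg_mulVec, slotOp_mulVec,
    unitOp_mulVec]
  abel

/-- The row-`r` vector paired with `X`: `Σ_k b_{kj₀} X_{(r,k)}`. -/
theorem rowVec_dotProduct (X : Vec n) :
    (fun p : Fin n × Fin n => if p.1 = r then B (p.2, j₀) else 0) ⬝ᵥ X =
      ∑ k, B (k, j₀) * X (r, k) := by
  rw [dotProduct, ← Finset.univ_product_univ, Finset.sum_product]
  rw [Finset.sum_eq_single r]
  · simp
  · intro i _ hi
    simp [hi]
  · simp

/-- Value of the pivot test: `c_⋆ · f_⋆ − Σ_k b_{kj₀} · f_{(r,k)}`. -/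
theorem pivotTest_eval :
    (pivotTest r s j₀).eval A B C =
      C (s, j₀) * (C - prodVec A B) (s, j₀) - ∑ k, B (k, j₀) * (C - prodVec A B) (r, k) := by
  rw [AffTest.eval, pivotTest_coef, sub_dotProduct, smul_dotProduct, single_dotProduct, one_mul,
    smul_eq_mul, rowVec_dotProduct]

/-- Gradient of the pivot test on the graph: `(AB)_⋆ e_⋆ − Σ_k b_{kj₀} e_{(r,k)}`. -/
theorem pivotTest_jac :
    (pivotTest r s j₀).jac A B =
      prodVec A B (s, j₀) • Pi.single (s, j₀) 1 - fun p => if p.1 = r then B (p.2, j₀) else 0 :=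
  pivotTest_coef r s j₀ A B _

/-- The quadratic part of the pivot test is `β_⋆(δ) = δ_⋆²`. -/
theorem quad_pivotTest (δ : Vec n) : (pivotTest r s j₀).quad δ = δ (s, j₀) * δ (s, j₀) := by
  simp [AffTest.quad, pivotTest, unitOp_mulVec, smul_dotProduct]

/-- Slot tests have no quadratic part. -/
theorem slotTest_M (k : Fin n) : (slotTest r s j₀ k).M = 0 := rfl

/-- Coordinate tests have no quadratic part. -/
theorem coordTest_M (q : Fin n × Fin n) : (coordTest q).M = 0 := rfl

/-- **Unmasking identity**: `T + Σ_k b_{kj₀} · t_{(r,k)} = f_⋆ · f_⋆` identically on `ℂ^{3n²}`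
(`n` products and `n` sums unmask the pivot). -/
theorem pivotTest_eval_add :
    (pivotTest r s j₀).eval A B C + ∑ k, B (k, j₀) * (slotTest r s j₀ k).eval A B C =
      (C - prodVec A B) (s, j₀) * (C - prodVec A B) (s, j₀) := by
  simp only [pivotTest_eval, slotTest_eval, mul_sub, Finset.sum_sub_distrib]
  have hprod : prodVec A B (s, j₀) = ∑ k, A (s, k) * B (k, j₀) := rfl
  have hC : C (s, j₀) = (C - prodVec A B) (s, j₀) + ∑ k, A (s, k) * B (k, j₀) := by
    simp [hprod]
  rw [hC]
  have hsum : ∑ k, B (k, j₀) * (A (s, k) * (C - prodVec A B) (s, j₀)) =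
      (∑ k, A (s, k) * B (k, j₀)) * (C - prodVec A B) (s, j₀) := by
    rw [Finset.sum_mul]; exact Finset.sum_congr rfl fun k _ => by ring
  rw [hsum]
  ring

end evals

/-! ## Correctness -/

/-- **The masked square system is CORRECT** (`r ≠ s`). -/
theorem cubicMaskSystem_correct {r s : Fin n} (hrs : r ≠ s) (j₀ : Fin n) :
    (cubicMaskSystem r s j₀).Correct := by
  intro A B C h
  set f : Vec n := C - prodVec A B with hf
  have hq : ∀ q : Fin n × Fin n, (cubicMaskTest r s j₀ q).eval A B C = 0 := fun q => by
    simpa [cubicMaskSystem_test] using h (flat n q)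
  -- coordinate tests
  have hcoord : ∀ q : Fin n × Fin n, q.1 ≠ r → q ≠ (s, j₀) → f q = 0 := by
    intro q h1 h2
    have := hq q
    rw [cubicMaskTest, if_neg h1, if_neg h2, coordTest_eval] at this
    exact this
  -- slot tests
  have hslot : ∀ k : Fin n, f (r, k) = A (s, k) * f (s, j₀) := by
    intro k
    have := hq (r, k)
    rw [cubicMaskTest, if_pos rfl, slotTest_eval] at this
    exact sub_eq_zero.mp this
  -- pivot test: `f_⋆² = 0`
  have hpiv : f (s, j₀) * f (s, j₀) = 0 := by
    have hT := hq (s, j₀)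
    have hne : ¬ ((s, j₀) : Fin n × Fin n).1 = r := fun h => hrs h.symm
    rw [cubicMaskTest, if_neg hne, if_pos rfl] at hT
    have hS : ∑ k, B (k, j₀) * (slotTest r s j₀ k).eval A B C = 0 :=
      Finset.sum_eq_zero fun k _ => by
        have := hq (r, k)
        rw [cubicMaskTest, if_pos rfl] at this
        rw [this, mul_zero]
    have key := pivotTest_eval_add r s j₀ A B C
    rw [hT, hS, zero_add] at key
    exact key.symm
  have hstar : f (s, j₀) = 0 := mul_self_eq_zero.mp hpiv
  have hzero : f = 0 := by
    funext q
    by_cases h1 : q.1 = r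
    · obtain ⟨q1, q2⟩ := q
      simp only at h1
      subst h1
      rw [hslot q2, hstar, mul_zero]; rfl
    · by_cases h2 : q = (s, j₀)
      · rw [h2, hstar]; rfl
      · exact hcoord q h1 h2
  exact sub_eq_zero.mp hzero

/-! ## The kernel field: masked everywhere -/

/-- The degree-`1` kernel field `Λ(A) = e_⋆ + Σ_k a_{sk} e_{(r,k)}`. -/
def kerField (r s j₀ : Fin n) (A : Vec n) : Vec n :=
  fun p => if p = (s, j₀) then 1 else if p.1 = r then A (s, p.2) else 0

/-- `Λ_⋆ = 1`. -/
theorem kerField_star (r s j₀ : Fin n) (A : Vec n) : kerField r s j₀ A (s, j₀) = 1 := by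
  simp [kerField]

/-- `Λ_{(r,k)} = a_{sk}` (`r ≠ s`). -/
theorem kerField_slot {r s : Fin n} (hrs : r ≠ s) (j₀ : Fin n) (A : Vec n) (k : Fin n) :
    kerField r s j₀ A (r, k) = A (s, k) := by
  have h : ((r, k) : Fin n × Fin n) ≠ (s, j₀) := fun h => hrs (Prod.mk.inj h).1
  simp [kerField, h]

/-- `Λ_q = 0` off row `r` and off the pivot. -/
theorem kerField_other (r s j₀ : Fin n) (A : Vec n) {q : Fin n × Fin n} (h1 : q.1 ≠ r)
    (h2 : q ≠ (s, j₀)) : kerField r s j₀ A q = 0 := by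
  simp [kerField, h1, h2]

/-- `Λ ≠ 0`. -/
theorem kerField_ne_zero (r s j₀ : Fin n) (A : Vec n) : kerField r s j₀ A ≠ 0 := fun h => by
  have := congr_fun h (s, j₀)
  rw [kerField_star] at this
  exact one_ne_zero this

/-- Pairing with the row-`r` vector: `Σ_k b_{kj₀} Λ_{(r,k)} = (AB)_⋆`. -/
theorem rowVec_dotProduct_kerField {r s : Fin n} (hrs : r ≠ s) (j₀ : Fin n) (A B : Vec n) :
    (fun p : Fin n × Fin n => if p.1 = r then B (p.2, j₀) else 0) ⬝ᵥ kerField r s j₀ A =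
      prodVec A B (s, j₀) := by
  rw [rowVec_dotProduct]
  simp only [kerField_slot hrs]
  show ∑ k, B (k, j₀) * A (s, k) = ∑ k, A (s, k) * B (k, j₀)
  exact Finset.sum_congr rfl fun k _ => mul_comm _ _

/-- **`Λ(A)` is a kernel direction at EVERY graph point** (`r ≠ s`). -/
theorem cubicMaskSystem_isKer {r s : Fin n} (hrs : r ≠ s) (j₀ : Fin n) (A B : Vec n) :
    (cubicMaskSystem r s j₀).IsKer A B (kerField r s j₀ A) := by
  intro i
  obtain ⟨q, rfl⟩ := (flat n).surjective i
  rw [cubicMaskSystem_test, cubicMaskTest]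
  by_cases h1 : q.1 = r
  · -- slot test: `Λ_{(r,k)} − a_{sk} Λ_⋆ = 0`
    rw [if_pos h1, slotTest_jac, sub_dotProduct, smul_dotProduct, single_dotProduct,
      single_dotProduct, one_mul, one_mul, kerField_star, smul_eq_mul, mul_one]
    obtain ⟨q1, q2⟩ := q
    simp only at h1
    subst h1
    rw [kerField_slot hrs, sub_self]
  · rw [if_neg h1]
    by_cases h2 : q = (s, j₀)
    · -- pivot test: `(AB)_⋆ Λ_⋆ − Σ_k b_{kj₀} Λ_{(r,k)} = 0`
      rw [if_pos h2, pivotTest_jac, sub_dotProduct, smul_dotProduct, single_dotProduct, one_mul,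
        kerField_star, smul_eq_mul, mul_one, rowVec_dotProduct_kerField hrs, sub_self]
    · -- coordinate test: `Λ_q = 0`
      rw [if_neg h2]
      simp [coordTest, AffTest.jac, AffTest.coef, kerField_other r s j₀ A h1 h2]

/-- **Masked at every graph point** (`r ≠ s`). -/
theorem cubicMaskSystem_not_reducedAt {r s : Fin n} (hrs : r ≠ s) (j₀ : Fin n) (A B : Vec n) :
    ¬ (cubicMaskSystem r s j₀).ReducedAt A B :=
  (AffSystem.not_reducedAt_iff A B).mpr ⟨_, cubicMaskSystem_isKer hrs j₀ A B, kerField_ne_zero r s j₀ A⟩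

/-- The masked square system is NOWHERE REDUCED. -/
theorem cubicMaskSystem_nowhereReduced {r s : Fin n} (hrs : r ≠ s) (j₀ : Fin n) :
    (cubicMaskSystem r s j₀).NowhereReduced :=
  fun A B => cubicMaskSystem_not_reducedAt hrs j₀ A B

/-- The data of NODE-g40 §3f, EXHIBITED: the only quadratic part is `β_⋆`, and it takes the constant
value `1` on the kernel field. -/
theorem pivotTest_quad_kerField (r s j₀ : Fin n) (A : Vec n) :
    (pivotTest r s j₀).quad (kerField r s j₀ A) = 1 := by
  rw [quad_pivotTest, kerField_star, mul_one]

/-- Every test other than the pivot has quadratic part `0` (`m_q = 1`). -/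
theorem cubicMaskTest_M_eq_zero (r s j₀ : Fin n) {q : Fin n × Fin n} (hq : q ≠ (s, j₀)) :
    (cubicMaskTest r s j₀ q).M = 0 := by
  unfold cubicMaskTest
  by_cases h1 : q.1 = r
  · rw [if_pos h1]; rfl
  · rw [if_neg h1, if_neg hq]; rfl

/-- The pivot position carries the pivot test (`r ≠ s`). -/
theorem cubicMaskTest_star {r s : Fin n} (hrs : r ≠ s) (j₀ : Fin n) :
    cubicMaskTest r s j₀ (s, j₀) = pivotTest r s j₀ := by
  have hne : ¬ ((s, j₀) : Fin n × Fin n).1 = r := fun h => hrs h.symm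
  rw [cubicMaskTest, if_neg hne, if_pos rfl]

end Summit.MatrixMultiplication.MatrixMultiplication.Theorems.GraphEquations

end
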